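import Summits.NavierStokesRegularity.NavierStokesRegularity.Theorems.ExtremiserTransienceNearExtremalTransienceDSSLogMean
import Mathlib.Algebra.Order.Floor.Defs
import HarnessLib

/-!
# Route `ExtremiserTransience`, crux `NearExtremalTransience` (stmt-NavierStokesRegularity-21883):
# NORMAL FORM OF THE BC5 RUNG (DSS stratum) — a UNIFORM bound on ONE period average per flow

`--supports stmt-NavierStokesRegularity-21883` (route-independent). Author: prover seat `ns-et-p1` (g2), on
`…SharpConstant`, `…Scaling`, `…DSSLogMean`.

The planner's BC5 rung of the crux (registered 2026-08-27 as `stub_dssStratumRung` of the birth skeleton v3, to be filed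
as an item by the route author) is the crux restricted to flows that are discretely self-similar about the singular time:
the crux hypotheses plus `∃ c > 1, IsDiscretelySelfSimilar c (fun s x => u (T + s) x)`, same conclusion
(onset, measurable flow-wise coefficient, `∫_{t₁}^t k²/(T−τ) ≤ (θκ)² log((T−t₁)/(T−t)) + B` for every universal `κ`).
Its statement is spelled out verbatim below (left side of `dssStratumRung_iff_periodAverage`).

* `dssStratumRung_iff_periodAverage` — **the rung holds iff there is ONE `θ ∈ [0,1)` such that along every such flow
  (DSS with factor `c > 1`) every minimal measurable coefficient `k₀` (the efficiency `R(t)`) has PERIOD MASS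
  `∫_{t₁}^{T−(T−t₁)/c²} k₀²/(T−τ) ≤ (θκ⋆)²·log(c²)` for every base point `t₁ ∈ [0,T)`** (`κ⋆ = sInf` of the universal
  constants, spelled out). `←`: take `t₁ = 0`, `k = k₀` canonical (`exists_canonical_coefficient`), `B =` the period
  mass, and `logMean_le_periodAverage_of_dss`; `→`: instantiate the rung at `κ⋆` (`sharpDepletion_is_universal`),
  compare `k₀ ≤ k` on the rung's onset ray, and sum `N` equal blocks (`dss_block_integral_eq`): `N·I₀ ≤ (θκ⋆)²·N·log(c²)
  + O(1)` for all large `N` forces `I₀ ≤ (θκ⋆)² log(c²)`.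

With `…DSSDichotomy` / `…DSSPerFlow` (per flow: `I₀ < κ⋆² log(c²)` unless a.e. slice of the period is an exact
maximiser) this pins the rung's content: ATTAINMENT of `κ⋆` and UNIFORMITY over DSS flows. WHAT THIS IS NOT: the rung is
not proved; no DSS blow-up is constructed or excluded; the crux, the route and the summit stay open; Navier–Stokes
regularity is NOT proved. [folklore]
-/

noncomputable section

open Set Filter Topology MeasureTheory
open scoped InnerProductSpace RealInnerProductSpace ENNReal NNReal ContDiff
open Literature.Analysis.FluidPDE

namespace Summit.NavierStokesRegularity.NavierStokesRegularity.Theorems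

-- the problem directory repeats the summit name (`NavierStokesRegularity/NavierStokesRegularity`)
set_option linter.dupNamespace false

namespace DepletionLadder

/-- **`N` blocks.** Along a DSS flow (factor `c > 1`) with a measurable minimal coefficient `k₀ : ℝ → [0,1]`, for every
base point `t₁ ∈ [0,T)` and `N : ℕ`: `∫_{t₁}^{T−(T−t₁)e^{−N log(c²)}} k₀²/(T−τ) = N · I₀` with the period mass
`I₀ = ∫_{t₁}^{T−(T−t₁)/c²} k₀²/(T−τ)` (all `N` blocks carry the mass `I₀`, `dss_block_integral_eq`). [folklore] -/
theorem dss_integral_blocks_eq_mul {c T t₁ : ℝ} (hc : 1 < c) (hT : 0 < T) (ht₁ : t₁ ∈ Ico 0 T)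
    {u : ℝ → EuclideanSpace ℝ (Fin 3) → EuclideanSpace ℝ (Fin 3)}
    (hdss : IsDiscretelySelfSimilar c (fun s x => u (T + s) x))
    {k₀ : ℝ → ℝ} (hk₀m : Measurable k₀) (hk₀01 : ∀ τ, 0 ≤ k₀ τ ∧ k₀ τ ≤ 1)
    (hcl : ∀ t ∈ Ico 0 T, ∀ M : ℝ, (∀ x, ‖u t x‖ ≤ M) →
      |∫ x, ⟪curl (u t) x, fderiv ℝ (u t) x (curl (u t) x)⟫_ℝ| ≤
        k₀ t * M * Real.sqrt (∫ x, ‖curl (u t) x‖ ^ 2) *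
          Real.sqrt (∫ x, frobeniusNormSq (fderiv ℝ (curl (u t)) x)))
    (hmin : ∀ t ∈ Ico 0 T, ∀ c : ℝ, 0 ≤ c →
      (∀ M : ℝ, (∀ x, ‖u t x‖ ≤ M) →
        |∫ x, ⟪curl (u t) x, fderiv ℝ (u t) x (curl (u t) x)⟫_ℝ| ≤
          c * M * Real.sqrt (∫ x, ‖curl (u t) x‖ ^ 2) *
            Real.sqrt (∫ x, frobeniusNormSq (fderiv ℝ (curl (u t)) x))) → k₀ t ≤ c)
    (N : ℕ) :
    ∫ τ in t₁..(T - (T - t₁) * Real.exp (-(N * Real.log (c ^ 2)))), k₀ τ ^ 2 / (T - τ) =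
      N * ∫ τ in t₁..(T - (T - t₁) / c ^ 2), k₀ τ ^ 2 / (T - τ) := by
  have hc0 : 0 < c := lt_trans one_pos hc
  have hℓ0 : 0 ≤ Real.log (c ^ 2) := Real.log_nonneg (by nlinarith)
  have hTt₁ : 0 < T - t₁ := sub_pos.2 ht₁.2
  obtain ⟨s, hs⟩ : ∃ s : ℕ → ℝ, ∀ n, s n = T - (T - t₁) * Real.exp (-(n * Real.log (c ^ 2))) :=
    ⟨_, fun _ => rfl⟩
  have hs0 : s 0 = t₁ := by rw [hs]; simp
  have hsT : ∀ n, s n < T := fun n => by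
    have h : 0 < (T - t₁) * Real.exp (-(n * Real.log (c ^ 2))) := mul_pos hTt₁ (Real.exp_pos _)
    rw [hs]; linarith
  have hs_mono : Monotone s := by
    intro m n hmn
    rw [hs, hs]
    have h : Real.exp (-(n * Real.log (c ^ 2))) ≤ Real.exp (-(m * Real.log (c ^ 2))) :=
      Real.exp_le_exp.2 (neg_le_neg (mul_le_mul_of_nonneg_right (Nat.cast_le.2 hmn) hℓ0))
    nlinarith
  have ht₁s : ∀ n, t₁ ≤ s n := fun n => by rw [← hs0]; exact hs_mono (Nat.zero_le n)
  have hblk_int : ∀ k < N, IntervalIntegrable (fun τ => k₀ τ ^ 2 / (T - τ)) volume (s k) (s (k + 1)) :=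
    fun k _ => intervalIntegrable_coeff_sq_div hk₀m hk₀01 (hs_mono (Nat.le_succ k)) (hsT _)
  have hsum := intervalIntegral.sum_integral_adjacent_intervals hblk_int
  rw [hs0] at hsum
  rw [← hs N, ← hsum]
  have hblock : ∀ k ∈ Finset.range N, ∫ τ in s k..s (k + 1), k₀ τ ^ 2 / (T - τ) =
      ∫ τ in t₁..(T - (T - t₁) / c ^ 2), k₀ τ ^ 2 / (T - τ) := by
    intro k _
    rw [hs, hs]
    push_cast
    exact dss_block_integral_eq hc hT ht₁ hdss (fun τ => (hk₀01 τ).1) hcl hmin k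
  rw [Finset.sum_congr rfl hblock, Finset.sum_const, Finset.card_range, nsmul_eq_mul]

/-- **NORMAL FORM OF THE BC5 RUNG.** The crux restricted to the DSS stratum (left: its statement verbatim, for every
universal `κ`) holds iff (right) there is one `θ ∈ [0,1)` such that along every Type-I singular classical Leray–Hopf
rapidly-decaying-datum flow that is discretely self-similar about `T` with factor `c > 1`, every measurable minimal
flow-wise coefficient `k₀ : ℝ → [0,1]` on `[0,T)` has period mass `∫_{t₁}^{T−(T−t₁)/c²} k₀²/(T−τ) ≤ (θκ⋆)²·log(c²)`
for every `t₁ ∈ [0,T)`. [folklore] -/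
theorem dssStratumRung_iff_periodAverage :
    (∃ θ : ℝ, 0 ≤ θ ∧ θ < 1 ∧ ∀ κ : ℝ, (∀ (v : EuclideanSpace ℝ (Fin 3) → EuclideanSpace ℝ (Fin 3)) (M B : ℝ), ContDiff ℝ (⊤ : ℕ∞) v → Literature.Analysis.FluidPDE.VectorCalculus.IsDivFree v → (∀ x, ‖v x‖ ≤ M) → (∀ x, ‖fderiv ℝ v x‖ ≤ B) → (∫⁻ x, ‖iteratedFDeriv ℝ 0 v x‖ₑ ^ 2 < ⊤) → (∫⁻ x, ‖iteratedFDeriv ℝ 1 v x‖ₑ ^ 2 < ⊤) → (∫⁻ x, ‖iteratedFDeriv ℝ 2 v x‖ₑ ^ 2 < ⊤) → |∫ x, ⟪Literature.Analysis.FluidPDE.curl v x, fderiv ℝ v x (Literature.Analysis.FluidPDE.curl v x)⟫_ℝ| ≤ κ * M * Real.sqrt (∫ x, ‖Literature.Analysis.FluidPDE.curl v x‖ ^ 2) * Real.sqrt (∫ x, Literature.Analysis.FluidPDE.frobeniusNormSq (fderiv ℝ (Literature.Analysis.FluidPDE.curl v) x))) → ∀ (C ν T : ℝ), 0 < C → 0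 < ν → 0 < T → ∀ (u : ℝ → EuclideanSpace ℝ (Fin 3) → EuclideanSpace ℝ (Fin 3)) (p : ℝ → EuclideanSpace ℝ (Fin 3) → ℝ), Literature.Analysis.FluidPDE.IsClassicalNSSolutionOn (Set.Ico 0 T) ν 0 u p → Literature.Analysis.FluidPDE.IsLerayHopfOn T ν 0 (u 0) u → Literature.Analysis.FluidPDE.HasRapidSpatialDecay (u 0) → (∃ c : ℝ, 1 < c ∧ Literature.Analysis.FluidPDE.IsDiscretelySelfSimilar c (fun s x => u (T + s) x)) → (∀ᶠ t in 𝓝[<] T, ∀ x, Real.sqrt (T - t) * ‖u t x‖ ≤ C * Real.sqrt ν) → ¬ Literature.Analysis.FluidPDE.HasSmoothExtensionPast ν 0 u T → ∃ t₁ ∈ Set.Ico 0 T, ∃ (k : ℝ → ℝ) (B : ℝ), Measurable k ∧ (∀ τ, 0 ≤ k τ ∧ k τ ≤ 1) ∧ (∀ t ∈ Set.Ico t₁ T, ∀ M : ℝ, (∀ x, ‖u t x‖ ≤ M) → |∫ x, ⟪Literature.Analysis.FluidPDE.curl (u t) x, fderiv ℝ (u t) x (Literature.Analysis.FluidPDE.curl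 (u t) x)⟫_ℝ| ≤ k t * M * Real.sqrt (∫ x, ‖Literature.Analysis.FluidPDE.curl (u t) x‖ ^ 2) * Real.sqrt (∫ x, Literature.Analysis.FluidPDE.frobeniusNormSq (fderiv ℝ (Literature.Analysis.FluidPDE.curl (u t)) x))) ∧ (∀ t ∈ Set.Ico t₁ T, ∫ τ in t₁..t, k τ ^ 2 / (T - τ) ≤ (θ * κ) ^ 2 * Real.log ((T - t₁) / (T - t)) + B)) ↔
    (∃ θ : ℝ, 0 ≤ θ ∧ θ < 1 ∧ ∀ (C ν T : ℝ), 0 < C → 0 < ν → 0 < T → ∀ (u : ℝ → EuclideanSpace ℝ (Fin 3) → EuclideanSpace ℝ (Fin 3)) (p : ℝ → EuclideanSpace ℝ (Fin 3) → ℝ), Literature.Analysis.FluidPDE.IsClassicalNSSolutionOn (Set.Ico 0 T) ν 0 u p → Literature.Analysis.FluidPDE.IsLerayHopfOn T ν 0 (u 0) u → Literature.Analysis.FluidPDE.HasRapidSpatialDecay (u 0) → (∀ᶠ t in 𝓝[<] T, ∀ x, Real.sqrt (T - t) * ‖u t x‖ ≤ C * Real.sqrt ν) → ¬ Literature.Analysis.FluidPDE.HasSmoothExtensionPast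 ν 0 u T → ∀ c : ℝ, 1 < c → Literature.Analysis.FluidPDE.IsDiscretelySelfSimilar c (fun s x => u (T + s) x) → ∀ k₀ : ℝ → ℝ, Measurable k₀ → (∀ τ, 0 ≤ k₀ τ ∧ k₀ τ ≤ 1) → (∀ t ∈ Set.Ico 0 T, ∀ M : ℝ, (∀ x, ‖u t x‖ ≤ M) → |∫ x, ⟪Literature.Analysis.FluidPDE.curl (u t) x, fderiv ℝ (u t) x (Literature.Analysis.FluidPDE.curl (u t) x)⟫_ℝ| ≤ k₀ t * M * Real.sqrt (∫ x, ‖Literature.Analysis.FluidPDE.curl (u t) x‖ ^ 2) * Real.sqrt (∫ x, Literature.Analysis.FluidPDE.frobeniusNormSq (fderiv ℝ (Literature.Analysis.FluidPDE.curl (u t)) x))) → (∀ t ∈ Set.Ico 0 T, ∀ c : ℝ, 0 ≤ c → (∀ M : ℝ, (∀ x, ‖u t x‖ ≤ M) → |∫ x, ⟪Literature.Analysis.FluidPDE.curl (u t) x, fderiv ℝ (u t) x (Literature.Analysis.FluidPDE.curl (u t) x)⟫_ℝ| ≤ c * M * Real.sqrt (∫ x, ‖Literature.Analysis.FluidPDE.curl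 (u t) x‖ ^ 2) * Real.sqrt (∫ x, Literature.Analysis.FluidPDE.frobeniusNormSq (fderiv ℝ (Literature.Analysis.FluidPDE.curl (u t)) x))) → k₀ t ≤ c) → ∀ t₁ ∈ Set.Ico 0 T, ∫ τ in t₁..(T - (T - t₁) / c ^ 2), k₀ τ ^ 2 / (T - τ) ≤ (θ * (sInf {κ : ℝ | (∀ (v : EuclideanSpace ℝ (Fin 3) → EuclideanSpace ℝ (Fin 3)) (M B : ℝ), ContDiff ℝ (⊤ : ℕ∞) v → Literature.Analysis.FluidPDE.VectorCalculus.IsDivFree v → (∀ x, ‖v x‖ ≤ M) → (∀ x, ‖fderiv ℝ v x‖ ≤ B) → (∫⁻ x, ‖iteratedFDeriv ℝ 0 v x‖ₑ ^ 2 < ⊤) → (∫⁻ x, ‖iteratedFDeriv ℝ 1 v x‖ₑ ^ 2 < ⊤) → (∫⁻ x, ‖iteratedFDeriv ℝ 2 v x‖ₑ ^ 2 < ⊤) → |∫ x, ⟪Literature.Analysis.FluidPDE.curl v x, fderiv ℝ v x (Literature.Analysis.FluidPDE.curl v x)⟫_ℝ| ≤ κ * M * Real.sqrt (∫ x, ‖Literature.Analysis.FluidPDE.curl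 v x‖ ^ 2) * Real.sqrt (∫ x, Literature.Analysis.FluidPDE.frobeniusNormSq (fderiv ℝ (Literature.Analysis.FluidPDE.curl v) x)))})) ^ 2 * Real.log (c ^ 2)) := by
  have hκpos : 0 < sInf {κ : ℝ | (∀ (v : EuclideanSpace ℝ (Fin 3) → EuclideanSpace ℝ (Fin 3)) (M B : ℝ), ContDiff ℝ (⊤ : ℕ∞) v → Literature.Analysis.FluidPDE.VectorCalculus.IsDivFree v → (∀ x, ‖v x‖ ≤ M) → (∀ x, ‖fderiv ℝ v x‖ ≤ B) → (∫⁻ x, ‖iteratedFDeriv ℝ 0 v x‖ₑ ^ 2 < ⊤) → (∫⁻ x, ‖iteratedFDeriv ℝ 1 v x‖ₑ ^ 2 < ⊤) → (∫⁻ x, ‖iteratedFDeriv ℝ 2 v x‖ₑ ^ 2 < ⊤) → |∫ x, ⟪Literature.Analysis.FluidPDE.curl v x, fderiv ℝ v x (Literature.Analysis.FluidPDE.curl v x)⟫_ℝ| ≤ κ * M * Real.sqrt (∫ x, ‖Literature.Analysis.FluidPDE.curl v x‖ ^ 2) * Real.sqrt (∫ x, Literature.Analysis.FluidPDE.frobeniusNormSq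 (fderiv ℝ (Literature.Analysis.FluidPDE.curl v) x)))} := lt_trans (by norm_num) sharpDepletion_gt
  constructor
  · rintro ⟨θ, hθ0, hθ1, H⟩
    refine ⟨θ, hθ0, hθ1, ?_⟩
    intro C ν T hC hν hT u p hsol hLH hdec hrate hext c hc hdss k₀ hk₀m hk₀01 hcl hmin t₁ ht₁
    obtain ⟨t₁', ht₁', k, B, hkm, hk01, hflow, hmean⟩ :=
      H _ sharpDepletion_is_universal C ν T hC hν hT u p hsol hLH hdec ⟨c, hc, hdss⟩ hrate hext
    have hc0 : 0 < c := lt_trans one_pos hc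
    have hc2 : 1 < c ^ 2 := by nlinarith
    have hℓ : 0 < Real.log (c ^ 2) := Real.log_pos hc2
    have hTt₁ : 0 < T - t₁ := sub_pos.2 ht₁.2
    have hTt₁' : 0 < T - t₁' := sub_pos.2 ht₁'.2
    set a : ℝ := (θ * sInf {κ : ℝ | (∀ (v : EuclideanSpace ℝ (Fin 3) → EuclideanSpace ℝ (Fin 3)) (M B : ℝ), ContDiff ℝ (⊤ : ℕ∞) v → Literature.Analysis.FluidPDE.VectorCalculus.IsDivFree v → (∀ x, ‖v x‖ ≤ M) → (∀ x, ‖fderiv ℝ v x‖ ≤ B) → (∫⁻ x, ‖iteratedFDeriv ℝ 0 v x‖ₑ ^ 2 < ⊤) → (∫⁻ x, ‖iteratedFDeriv ℝ 1 v x‖ₑ ^ 2 < ⊤) → (∫⁻ x, ‖iteratedFDeriv ℝ 2 v x‖ₑ ^ 2 < ⊤) → |∫ x, ⟪Literature.Analysis.FluidPDE.curl v x, fderiv ℝ v x (Literature.Analysis.FluidPDE.curl v x)⟫_ℝ| ≤ κ * M * Real.sqrt (∫ x, ‖Literature.Analysis.FluidPDE.curl v x‖ ^ 2) * Real.sqrt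 (∫ x, Literature.Analysis.FluidPDE.frobeniusNormSq (fderiv ℝ (Literature.Analysis.FluidPDE.curl v) x)))}) ^ 2 with ha
    have ha0 : 0 ≤ a := sq_nonneg _
    set I₀ : ℝ := ∫ τ in t₁..(T - (T - t₁) / c ^ 2), k₀ τ ^ 2 / (T - τ) with hI₀
    -- the block endpoints from `t₁`
    obtain ⟨s, hs⟩ : ∃ s : ℕ → ℝ, ∀ n, s n = T - (T - t₁) * Real.exp (-(n * Real.log (c ^ 2))) :=
      ⟨_, fun _ => rfl⟩
    have hsT : ∀ n, s n < T := fun n => by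
      have h : 0 < (T - t₁) * Real.exp (-(n * Real.log (c ^ 2))) := mul_pos hTt₁ (Real.exp_pos _)
      rw [hs]; linarith
    have ht₁s : ∀ n, t₁ ≤ s n := fun n => by
      have h : (T - t₁) * Real.exp (-(n * Real.log (c ^ 2))) ≤ (T - t₁) * 1 :=
        mul_le_mul_of_nonneg_left (Real.exp_le_one_iff.2 (by
          have : (0:ℝ) ≤ n * Real.log (c ^ 2) := mul_nonneg (Nat.cast_nonneg n) hℓ.le
          linarith)) hTt₁.le
      rw [hs]; linarith
    -- `∫_{t₁}^{s N} = N I₀`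
    have hN : ∀ N : ℕ, ∫ τ in t₁..s N, k₀ τ ^ 2 / (T - τ) = N * I₀ := fun N => by
      rw [hs]; exact dss_integral_blocks_eq_mul hc hT ht₁ hdss hk₀m hk₀01 hcl hmin N
    -- the rung's bound transported to `k₀` on `[t₁', T)`
    have hmean₀ : ∀ t ∈ Ico t₁' T, ∫ τ in t₁'..t, k₀ τ ^ 2 / (T - τ) ≤
        a * Real.log ((T - t₁') / (T - t)) + B := by
      intro t ht
      refine le_trans ?_ (hmean t ht)
      refine intervalIntegral.integral_mono_on ht.1
        (intervalIntegrable_coeff_sq_div hk₀m hk₀01 ht.1 ht.2)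
        (intervalIntegrable_coeff_sq_div hkm hk01 ht.1 ht.2) fun τ hτ => ?_
      have hτ' : τ ∈ Ico t₁' T := ⟨hτ.1, lt_of_le_of_lt hτ.2 ht.2⟩
      have hle : k₀ τ ≤ k τ :=
        hmin τ ⟨ht₁'.1.trans hτ'.1, hτ'.2⟩ (k τ) (hk01 τ).1 (hflow τ hτ')
      exact div_le_div_of_nonneg_right (pow_le_pow_left₀ (hk₀01 τ).1 hle 2) (sub_pos.2 hτ'.2).le
    -- comparison constant: `∫_{t₁}^{t} ≤ D₀ + ∫_{t₁'}^{t}` for `t ≥ max t₁ t₁'`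
    set t₂ : ℝ := max t₁ t₁' with ht₂
    have ht₂T : t₂ < T := max_lt ht₁.2 ht₁'.2
    set D₀ : ℝ := ∫ τ in t₁..t₂, k₀ τ ^ 2 / (T - τ) with hD₀
    have hcomp : ∀ t ∈ Ico t₂ T, ∫ τ in t₁..t, k₀ τ ^ 2 / (T - τ) ≤
        D₀ + ∫ τ in t₁'..t, k₀ τ ^ 2 / (T - τ) := by
      intro t ht
      have h12 : t₁ ≤ t₂ := le_max_left _ _
      have h12' : t₁' ≤ t₂ := le_max_right _ _
      have hsplit : ∫ τ in t₁..t, k₀ τ ^ 2 / (T - τ) = D₀ + ∫ τ in t₂..t, k₀ τ ^ 2 / (T - τ) :=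
        (intervalIntegral.integral_add_adjacent_intervals
          (intervalIntegrable_coeff_sq_div hk₀m hk₀01 h12 ht₂T)
          (intervalIntegrable_coeff_sq_div hk₀m hk₀01 ht.1 ht.2)).symm
      have hsplit' : ∫ τ in t₁'..t, k₀ τ ^ 2 / (T - τ) =
          (∫ τ in t₁'..t₂, k₀ τ ^ 2 / (T - τ)) + ∫ τ in t₂..t, k₀ τ ^ 2 / (T - τ) :=
        (intervalIntegral.integral_add_adjacent_intervals
          (intervalIntegrable_coeff_sq_div hk₀m hk₀01 h12' ht₂T)
          (intervalIntegrable_coeff_sq_div hk₀m hk₀01 ht.1 ht.2)).symm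
      have hnn : 0 ≤ ∫ τ in t₁'..t₂, k₀ τ ^ 2 / (T - τ) :=
        intervalIntegral.integral_nonneg h12' fun τ hτ => div_nonneg (sq_nonneg _) (by linarith [hτ.2])
      rw [hsplit, hsplit']
      linarith
    -- contradiction if `I₀ > a ℓ`
    by_contra hgt
    push Not at hgt
    have hδ : 0 < I₀ - a * Real.log (c ^ 2) := sub_pos.2 hgt
    set K : ℝ := D₀ + a * Real.log ((T - t₁') / (T - t₁)) + B with hK
    -- choose `N` with `N δ > K` and `s N ≥ t₂`
    obtain ⟨N₁, hN₁⟩ := exists_nat_gt (K / (I₀ - a * Real.log (c ^ 2)))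
    obtain ⟨N₂, hN₂⟩ := exists_nat_gt (Real.log ((T - t₁) / (T - t₂)) / Real.log (c ^ 2))
    set N : ℕ := max N₁ N₂ with hNdef
    have hNN₁ : (N₁ : ℝ) ≤ N := Nat.cast_le.2 (le_max_left _ _)
    have hNN₂ : (N₂ : ℝ) ≤ N := Nat.cast_le.2 (le_max_right _ _)
    have hsN₂ : t₂ ≤ s N := by
      -- `e^{−N ℓ} ≤ (T − t₂)/(T − t₁)`
      have hTt₂ : 0 < T - t₂ := sub_pos.2 ht₂T
      have h1 : Real.log ((T - t₁) / (T - t₂)) ≤ N * Real.log (c ^ 2) := by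
        have := (div_lt_iff₀ hℓ).1 (lt_of_lt_of_le hN₂ hNN₂)
        linarith
      have h2 : Real.exp (-(N * Real.log (c ^ 2))) ≤ (T - t₂) / (T - t₁) := by
        rw [← Real.exp_log (div_pos hTt₂ hTt₁)]
        refine Real.exp_le_exp.2 ?_
        rw [Real.log_div hTt₂.ne' hTt₁.ne']
        rw [Real.log_div hTt₁.ne' hTt₂.ne'] at h1
        linarith
      have h3 : (T - t₁) * Real.exp (-(N * Real.log (c ^ 2))) ≤ T - t₂ := by
        calc (T - t₁) * Real.exp (-(N * Real.log (c ^ 2))) ≤ (T - t₁) * ((T - t₂) / (T - t₁)) :=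
              mul_le_mul_of_nonneg_left h2 hTt₁.le
          _ = T - t₂ := by field_simp
      rw [hs]; linarith
    have hsN : s N ∈ Ico t₂ T := ⟨hsN₂, hsT N⟩
    have hsN' : s N ∈ Ico t₁' T := ⟨(le_max_right _ _).trans hsN₂, hsT N⟩
    -- the chain of inequalities at `t = s N`
    have hlogN : Real.log ((T - t₁') / (T - s N)) = Real.log ((T - t₁') / (T - t₁)) + N * Real.log (c ^ 2) := by
      have hsub : T - s N = (T - t₁) * Real.exp (-(N * Real.log (c ^ 2))) := by rw [hs]; ring
      rw [hsub, ← div_div, Real.log_div (div_pos hTt₁' hTt₁).ne' (Real.exp_pos _).ne', Real.log_exp]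
      ring
    have hchain : (N : ℝ) * I₀ ≤ K + N * (a * Real.log (c ^ 2)) := by
      calc (N : ℝ) * I₀ = ∫ τ in t₁..s N, k₀ τ ^ 2 / (T - τ) := (hN N).symm
        _ ≤ D₀ + ∫ τ in t₁'..s N, k₀ τ ^ 2 / (T - τ) := hcomp _ hsN
        _ ≤ D₀ + (a * Real.log ((T - t₁') / (T - s N)) + B) := by linarith [hmean₀ _ hsN']
        _ = K + N * (a * Real.log (c ^ 2)) := by rw [hlogN, hK]; ring
    have hN₁' : K / (I₀ - a * Real.log (c ^ 2)) < N := lt_of_lt_of_le hN₁ hNN₁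
    rw [div_lt_iff₀ hδ] at hN₁'
    nlinarith
  · rintro ⟨θ, hθ0, hθ1, H⟩
    refine ⟨θ, hθ0, hθ1, ?_⟩
    intro κ hκ C ν T hC hν hT u p hsol hLH hdec hdssE hrate hext
    obtain ⟨c, hc, hdss⟩ := hdssE
    have hc0 : 0 < c := lt_trans one_pos hc
    have hc2 : 1 < c ^ 2 := by nlinarith
    have hℓ : 0 < Real.log (c ^ 2) := Real.log_pos hc2
    obtain ⟨k₀, hk₀m, hk₀01, hcl, hmin⟩ := exists_canonical_coefficient hν hT hsol hLH hdec
    have h0T : (0 : ℝ) ∈ Ico 0 T := ⟨le_rfl, hT⟩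
    set I₀ : ℝ := ∫ τ in (0 : ℝ)..(T - (T - 0) / c ^ 2), k₀ τ ^ 2 / (T - τ) with hI₀
    have hPA : I₀ ≤ (θ * sInf {κ : ℝ | (∀ (v : EuclideanSpace ℝ (Fin 3) → EuclideanSpace ℝ (Fin 3)) (M B : ℝ), ContDiff ℝ (⊤ : ℕ∞) v → Literature.Analysis.FluidPDE.VectorCalculus.IsDivFree v → (∀ x, ‖v x‖ ≤ M) → (∀ x, ‖fderiv ℝ v x‖ ≤ B) → (∫⁻ x, ‖iteratedFDeriv ℝ 0 v x‖ₑ ^ 2 < ⊤) → (∫⁻ x, ‖iteratedFDeriv ℝ 1 v x‖ₑ ^ 2 < ⊤) → (∫⁻ x, ‖iteratedFDeriv ℝ 2 v x‖ₑ ^ 2 < ⊤) → |∫ x, ⟪Literature.Analysis.FluidPDE.curl v x, fderiv ℝ v x (Literature.Analysis.FluidPDE.curl v x)⟫_ℝ| ≤ κ * M * Real.sqrt (∫ x, ‖Literature.Analysis.FluidPDE.curl v x‖ ^ 2) * Real.sqrt (∫ x, Literature.Analysis.FluidPDE.frobeniusNormSq (fderiv ℝ (Literature.Analysis.FluidPDE.curl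 v) x)))}) ^ 2 * Real.log (c ^ 2) :=
      H C ν T hC hν hT u p hsol hLH hdec hrate hext c hc hdss k₀ hk₀m hk₀01 hcl hmin 0 h0T
    refine ⟨0, h0T, k₀, I₀, hk₀m, hk₀01, hcl, fun t ht => ?_⟩
    have hmain := logMean_le_periodAverage_of_dss hc hT h0T hdss hk₀m hk₀01 hcl hmin t ht
    refine hmain.trans ?_
    have hlog : 0 ≤ Real.log ((T - 0) / (T - t)) :=
      Real.log_nonneg ((one_le_div (sub_pos.2 ht.2)).2 (by linarith [ht.1]))
    have hs0 : 0 ≤ sInf {κ : ℝ | (∀ (v : EuclideanSpace ℝ (Fin 3) → EuclideanSpace ℝ (Fin 3)) (M B : ℝ), ContDiff ℝ (⊤ : ℕ∞) v → Literature.Analysis.FluidPDE.VectorCalculus.IsDivFree v → (∀ x, ‖v x‖ ≤ M) → (∀ x, ‖fderiv ℝ v x‖ ≤ B) → (∫⁻ x, ‖iteratedFDeriv ℝ 0 v x‖ₑ ^ 2 < ⊤) → (∫⁻ x, ‖iteratedFDeriv ℝ 1 v x‖ₑ ^ 2 < ⊤) → (∫⁻ x, ‖iteratedFDeriv ℝ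 2 v x‖ₑ ^ 2 < ⊤) → |∫ x, ⟪Literature.Analysis.FluidPDE.curl v x, fderiv ℝ v x (Literature.Analysis.FluidPDE.curl v x)⟫_ℝ| ≤ κ * M * Real.sqrt (∫ x, ‖Literature.Analysis.FluidPDE.curl v x‖ ^ 2) * Real.sqrt (∫ x, Literature.Analysis.FluidPDE.frobeniusNormSq (fderiv ℝ (Literature.Analysis.FluidPDE.curl v) x)))} := hκpos.le
    have hle : sInf {κ : ℝ | (∀ (v : EuclideanSpace ℝ (Fin 3) → EuclideanSpace ℝ (Fin 3)) (M B : ℝ), ContDiff ℝ (⊤ : ℕ∞) v → Literature.Analysis.FluidPDE.VectorCalculus.IsDivFree v → (∀ x, ‖v x‖ ≤ M) → (∀ x, ‖fderiv ℝ v x‖ ≤ B) → (∫⁻ x, ‖iteratedFDeriv ℝ 0 v x‖ₑ ^ 2 < ⊤) → (∫⁻ x, ‖iteratedFDeriv ℝ 1 v x‖ₑ ^ 2 < ⊤) → (∫⁻ x, ‖iteratedFDeriv ℝ 2 v x‖ₑ ^ 2 < ⊤) → |∫ x, ⟪Literature.Analysis.FluidPDE.curl v x, fderiv ℝ v x (Literature.Analysis.FluidPDE.curl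 v x)⟫_ℝ| ≤ κ * M * Real.sqrt (∫ x, ‖Literature.Analysis.FluidPDE.curl v x‖ ^ 2) * Real.sqrt (∫ x, Literature.Analysis.FluidPDE.frobeniusNormSq (fderiv ℝ (Literature.Analysis.FluidPDE.curl v) x)))} ≤ κ := sharpDepletion_le hκ
    have hsq : (θ * sInf {κ : ℝ | (∀ (v : EuclideanSpace ℝ (Fin 3) → EuclideanSpace ℝ (Fin 3)) (M B : ℝ), ContDiff ℝ (⊤ : ℕ∞) v → Literature.Analysis.FluidPDE.VectorCalculus.IsDivFree v → (∀ x, ‖v x‖ ≤ M) → (∀ x, ‖fderiv ℝ v x‖ ≤ B) → (∫⁻ x, ‖iteratedFDeriv ℝ 0 v x‖ₑ ^ 2 < ⊤) → (∫⁻ x, ‖iteratedFDeriv ℝ 1 v x‖ₑ ^ 2 < ⊤) → (∫⁻ x, ‖iteratedFDeriv ℝ 2 v x‖ₑ ^ 2 < ⊤) → |∫ x, ⟪Literature.Analysis.FluidPDE.curl v x, fderiv ℝ v x (Literature.Analysis.FluidPDE.curl v x)⟫_ℝ| ≤ κ * M * Real.sqrt (∫ x, ‖Literature.Analysis.FluidPDE.curl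 v x‖ ^ 2) * Real.sqrt (∫ x, Literature.Analysis.FluidPDE.frobeniusNormSq (fderiv ℝ (Literature.Analysis.FluidPDE.curl v) x)))}) ^ 2 ≤ (θ * κ) ^ 2 :=
      pow_le_pow_left₀ (mul_nonneg hθ0 hs0) (mul_le_mul_of_nonneg_left hle hθ0) 2
    have hA : I₀ / Real.log (c ^ 2) ≤ (θ * κ) ^ 2 := by
      rw [div_le_iff₀ hℓ]
      exact hPA.trans (mul_le_mul_of_nonneg_right hsq hℓ.le)
    have := mul_le_mul_of_nonneg_right hA hlog
    linarith

end DepletionLadder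

end Summit.NavierStokesRegularity.NavierStokesRegularity.Theorems

end
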